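import Mathlib
import Summits.NavierStokesRegularity.NavierStokesRegularity.Theorems.FilamentSkeletonRssDefectColumnGateLogCutoff

/-!
# Route `FilamentSkeletonRss` · cruxes `TransverseReduction1AL` (stmt-NavierStokesRegularity-23297) / `TransverseReduction1AR`
# (stmt-23611) · registered stub S2a-loc `WaistColumnGateLoc1A` — the AXIAL direction of the frozen waist-column operator has NO
# spectral gap: neutral (log-oscillating) quasimodes of `κτ∂_τ − ∂_τ²` at EVERY point of the imaginary axis

Helper file (theorems only, def-free; `--supports stmt-NavierStokesRegularity-23297 --as helper`; hand leafhand-ns-filamentskeletonrs-13 g0).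

WHY.  In the vorticity form of the S2a operator (`colForceVort_eq`, `Theorems/…ColumnVorticity.lean`) the axial station `τ = ⟨y, d⟩`
enters through the transport `Dω[By] ∋ κτ∂_τ ω` (`B d = κ d`, `κ ≥ 3/2 + δ`) and the diffusion `−Δ ∋ −∂_τ²`; everything else is
sectional.  The registered stub S2a-loc lets the perturbation `W` depend on `τ` with NO axial localisation or decay (only the sectional
support `|ξ| ≤ R` is bounded).  The one-variable operator `N = κτ∂_τ − ∂_τ²` on bounded smooth profiles has approximate point spectrum
containing the WHOLE IMAGINARY AXIS: for every real `ν` the log-oscillating bumps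
`f + i g = χ₀(log(τ/X)/L) · (τ/X)^{iν/κ}` (`χ₀` = `bump12`, `L, X → ∞`) satisfy `‖(N − iν)(f + ig)‖_∞ ≤ ε` while `|f|² + |g|² = χ₀²`
keeps its size (`axial_neutral_quasimodes`).  Consequence for any proof of S2a-loc (planner-facing, not a refutation): on axially
modulated fields `W = Re[(f+ig)(τ)·W₀(ξ)]` the 3D operator acts, up to `ε`, as the SECTIONAL operator shifted by `iν`; so the
sectional a-priori bounds the line is assembling (radial gate `m = 0`, dipole sector, azimuthal blocks, two-zone bounds) must hold
for the sectional operator `A_sec + iν` UNIFORMLY IN `ν ∈ ℝ`, not only at `ν = 0` (the `τ`-independent reduction).  The landed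
azimuthal blocks `|m| ≥ 3` (`azimuthalBlock_apriori`, arbitrary real potential `V`) absorb `ν` into `V` for free; the `m = 0` radial
gate (`waistColumnGateLoc1A_radial`, a REAL scalar argument) and the `m = ±1, ±2` sectors are the places where `ν ≠ 0` is new work.
Conversely no refutation comes from the axial direction alone: a 3D quasimode needs a sectional quasimode of `A_sec + iν` as well.

Contents: §1 small facts on `χ₀` (`bump12 ≤ 1`, `χ₀(3/2) > 0`, a bound on `χ₀′`, vanishing of Euler steps above `2`, boundedness of
shapes supported in `[1,2]`); §2 `logProfile_package` — for a smooth shape `ψ` supported in `[1,2]`, the dilated log-scale profile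
`x ↦ ψ(log(x/X)/L)` is smooth, `x·f′(x) = (ψ′/L)(log(x/X)/L)` EXACTLY (the Euler step of `Theorems/…LogCutoff.lean`), and
`|f″| ≤ M₂(ψ,L)/X²` with `M₂` independent of the dilation `X`; §3 the quasimodes.
HONEST FRAMING: elementary one-variable real analysis about ONE MODEL operator of a hypothetical filament-type blow-up route (MODEL rung,
negative side); `WaistColumnGateLoc1A`, `TransverseReduction1AL/1AR` are neither proved nor refuted; nothing here bears on Navier–Stokes
regularity.
-/

set_option linter.dupNamespace false

noncomputable section

namespace Summit.NavierStokesRegularity.NavierStokesRegularity.Theorems.DefectColumnGate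

open scoped Topology ContDiff
open Set Function Filter

/-! ## 1. Small facts on the bump `χ₀` and on shapes supported in `[1, 2]` -/

/-- `expNegInvGlue ≤ 1`. -/
theorem expNegInvGlue_le_one (x : ℝ) : expNegInvGlue x ≤ 1 := by
  unfold expNegInvGlue
  split_ifs with h
  · exact zero_le_one
  · have hx : 0 < x := lt_of_not_ge h
    exact Real.exp_le_one_iff.mpr (neg_nonpos.mpr (inv_nonneg.mpr hx.le))

/-- `χ₀ ≤ 1`. -/
theorem bump12_le_one (t : ℝ) : bump12 t ≤ 1 := by
  unfold bump12
  have h1 := expNegInvGlue_le_one (t - 1)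
  have h2 := expNegInvGlue_le_one (2 - t)
  have h3 := expNegInvGlue.nonneg (t - 1)
  have h4 := expNegInvGlue.nonneg (2 - t)
  nlinarith

/-- `χ₀(3/2) > 0`: the quasimodes below are not trivial. -/
theorem bump12_three_halves_pos : 0 < bump12 (3/2) := bump12_pos (by norm_num) (by norm_num)

/-- A bound on `χ₀′`. -/
theorem exists_bound_deriv_bump12 : ∃ M : ℝ, 0 ≤ M ∧ ∀ t, |deriv bump12 t| ≤ M := by
  obtain ⟨M, hM⟩ := exists_bound_iteratedDeriv_bump12 1
  refine ⟨max M 0, le_max_right _ _, fun t => ?_⟩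
  have h := hM t
  rw [iteratedDeriv_one] at h
  exact h.trans (le_max_left _ _)

/-- The Euler step preserves vanishing above `2`. -/
theorem eulerStep_eq_zero_of_two_lt {ψ : ℝ → ℝ} (hψ2 : ∀ t, 2 < t → ψ t = 0) (L : ℝ) (n : ℕ) {t : ℝ} (ht : 2 < t) :
    eulerStep L n ψ t = 0 := by
  have h : ψ =ᶠ[𝓝 t] fun _ => (0:ℝ) := (eventually_gt_nhds ht).mono fun s hs => hψ2 s hs
  rw [eulerStep, h.deriv_eq, deriv_const, hψ2 t ht]; simp

/-- A continuous shape vanishing off `[1, 2]` is bounded. -/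
theorem exists_bound_of_support_12 {φ : ℝ → ℝ} (hφ : Continuous φ) (h1 : ∀ t, t < 1 → φ t = 0) (h2 : ∀ t, 2 < t → φ t = 0) :
    ∃ M : ℝ, 0 ≤ M ∧ ∀ t, |φ t| ≤ M := by
  have hK : HasCompactSupport φ := by
    refine HasCompactSupport.intro (isCompact_Icc : IsCompact (Icc (1:ℝ) 2)) fun t ht => ?_
    rw [mem_Icc, not_and_or, not_le, not_le] at ht
    rcases ht with ht | ht
    · exact h1 t ht
    · exact h2 t ht
  obtain ⟨M, hM⟩ := hφ.bounded_above_of_compact_support hK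
  refine ⟨max M 0, le_max_right _ _, fun t => ?_⟩
  have := hM t
  rw [Real.norm_eq_abs] at this
  exact this.trans (le_max_left _ _)

/-- If the log-scale argument `log y / L` is at least `1` (`0 < L`), then `1 ≤ |y|`. -/
theorem one_le_abs_of_one_le_logArg {L y : ℝ} (hL : 0 < L) (h : 1 ≤ Real.log y / L) : 1 ≤ |y| := by
  by_contra hy
  have hy' : |y| ≤ 1 := (not_le.mp hy).le
  have hlog : Real.log y ≤ 0 := by rw [← Real.log_abs]; exact Real.log_nonpos (abs_nonneg _) hy'
  have : Real.log y / L ≤ 0 := div_nonpos_of_nonpos_of_nonneg hlog hL.le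
  linarith

/-! ## 2. The dilated log-scale profile package -/

/-- **Log-scale profile package.**  For a smooth shape `ψ` vanishing off `[1, 2]` and `0 < L` there is `M₂ ≥ 0` such that for EVERY
dilation `X > 0` the profile `f(x) = ψ(log(x/X)/L)` is smooth, satisfies the EXACT Euler identity `x·f′(x) = (eulerStep L 0 ψ)(log(x/X)/L)`
(`= ψ′(log(x/X)/L)/L`), and `|f″(x)| ≤ M₂/X²` (the second derivative is killed by the dilation, the first-order identity is dilation
invariant). -/
theorem logProfile_package {ψ : ℝ → ℝ} (hψ : ContDiff ℝ ∞ ψ) (h1 : ∀ t, t < 1 → ψ t = 0) (h2 : ∀ t, 2 < t → ψ t = 0)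
    {L : ℝ} (hL : 0 < L) :
    ∃ M₂ : ℝ, 0 ≤ M₂ ∧ ∀ X : ℝ, 0 < X →
      ContDiff ℝ ∞ (fun x => ψ (Real.log (x / X) / L)) ∧
      (∀ x, x * deriv (fun x => ψ (Real.log (x / X) / L)) x = eulerStep L 0 ψ (Real.log (x / X) / L)) ∧
      (∀ x, |deriv (deriv (fun x => ψ (Real.log (x / X) / L))) x| ≤ M₂ / X ^ 2) := by
  -- shapes: E = ψ′/L (Euler step of order 0) and E₂ = Euler step of order 1 of E
  set E : ℝ → ℝ := eulerStep L 0 ψ with hEdef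
  set E₂ : ℝ → ℝ := eulerStep L 1 E with hE₂def
  have hψ3 : ContDiff ℝ ((2 : ℕ∞) + 1) ψ := hψ.of_le (by exact_mod_cast le_top)
  have hψd : Differentiable ℝ ψ := hψ.differentiable (by simp)
  have hE2 : ContDiff ℝ (2 : ℕ∞) E := contDiff_eulerStep hψ3 L 0
  have hE2' : ContDiff ℝ ((1 : ℕ∞) + 1) E := hE2.of_le (by exact_mod_cast le_rfl)
  have hEd : Differentiable ℝ E := hE2.differentiable (by norm_num)
  have hE₂1 : ContDiff ℝ (1 : ℕ∞) E₂ := contDiff_eulerStep hE2' L 1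
  have hE₂c : Continuous E₂ := hE₂1.continuous
  have hE1 : ∀ t, t < 1 → E t = 0 := fun t ht => eulerStep_eq_zero_of_lt_one h1 L 0 ht
  have hE2z : ∀ t, 2 < t → E t = 0 := fun t ht => eulerStep_eq_zero_of_two_lt h2 L 0 ht
  have hE₂1z : ∀ t, t < 1 → E₂ t = 0 := fun t ht => eulerStep_eq_zero_of_lt_one hE1 L 1 ht
  have hE₂2z : ∀ t, 2 < t → E₂ t = 0 := fun t ht => eulerStep_eq_zero_of_two_lt hE2z L 1 ht
  obtain ⟨M₂, hM₂0, hM₂⟩ := exists_bound_of_support_12 hE₂c hE₂1z hE₂2z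
  refine ⟨M₂, hM₂0, fun X hX => ?_⟩
  have hX0 : X ≠ 0 := hX.ne'
  -- derivative of the undilated profile and of its first derivative (Euler steps, `Theorems/…LogCutoff.lean`)
  have hΦ : ∀ y, HasDerivAt (fun y => ψ (Real.log y / L)) (E (Real.log y / L) * (y ^ 1)⁻¹) y := by
    intro y
    have h := hasDerivAt_logScale' hψd h1 hL 0 y
    simp only [pow_zero, inv_one, mul_one] at h
    exact h
  have hΦ₁ : ∀ y, HasDerivAt (fun y => E (Real.log y / L) * (y ^ 1)⁻¹) (E₂ (Real.log y / L) * (y ^ 2)⁻¹) y :=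
    fun y => hasDerivAt_logScale' hEd hE1 hL 1 y
  -- the dilated profile
  have hf : ∀ x, HasDerivAt (fun x => ψ (Real.log (x / X) / L)) (E (Real.log (x / X) / L) * ((x / X) ^ 1)⁻¹ * (1 / X)) x := by
    intro x
    have h := HasDerivAt.comp x (hΦ (x / X)) ((hasDerivAt_id x).div_const X)
    exact h
  have hf_deriv : deriv (fun x => ψ (Real.log (x / X) / L)) = fun x => E (Real.log (x / X) / L) * ((x / X) ^ 1)⁻¹ * (1 / X) :=
    funext fun x => (hf x).deriv
  have hf₁ : ∀ x, HasDerivAt (fun x => E (Real.log (x / X) / L) * ((x / X) ^ 1)⁻¹ * (1 / X))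
      (E₂ (Real.log (x / X) / L) * ((x / X) ^ 2)⁻¹ * (1 / X) * (1 / X)) x := by
    intro x
    have h := (HasDerivAt.comp x (hΦ₁ (x / X)) ((hasDerivAt_id x).div_const X)).mul_const (1 / X)
    exact h
  refine ⟨?_, fun x => ?_, fun x => ?_⟩
  · -- smoothness
    have h := contDiff_logScale (m := (⊤ : ℕ∞)) hψ h1 hL 0
    simp only [pow_zero, inv_one, mul_one] at h
    exact h.comp (contDiff_id.div_const X)
  · -- the Euler identity `x f′(x) = E(log(x/X)/L)`
    rw [hf_deriv]
    rcases eq_or_ne x 0 with rfl | hx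
    · simp only [zero_div, Real.log_zero, zero_mul]
      exact (hE1 0 one_pos).symm
    · simp only [pow_one]
      field_simp
  · -- the second derivative
    rw [hf_deriv, (hf₁ x).deriv]
    rcases lt_or_ge (Real.log (x / X) / L) 1 with ht | ht
    · rw [hE₂1z _ ht]
      simp only [zero_mul, abs_zero]
      positivity
    · have hy : 1 ≤ |x / X| := one_le_abs_of_one_le_logArg hL ht
      have hy2 : 1 ≤ (x / X) ^ 2 := by
        have : 1 ≤ |x / X| ^ 2 := one_le_pow₀ hy
        simpa [sq_abs] using this
      have hinv : |((x / X) ^ 2)⁻¹| ≤ 1 := by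
        rw [abs_inv, abs_of_nonneg (by positivity)]
        exact inv_le_one_of_one_le₀ hy2
      have hXX : (1 / X) * (1 / X) = 1 / X ^ 2 := by field_simp
      calc |E₂ (Real.log (x / X) / L) * ((x / X) ^ 2)⁻¹ * (1 / X) * (1 / X)|
          = |E₂ (Real.log (x / X) / L)| * |((x / X) ^ 2)⁻¹| * (1 / X ^ 2) := by
            rw [mul_assoc, hXX, abs_mul, abs_mul, abs_of_pos (by positivity : (0:ℝ) < 1 / X ^ 2)]
        _ ≤ M₂ * 1 * (1 / X ^ 2) := by
            gcongr
            exact hM₂ _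
        _ = M₂ / X ^ 2 := by ring


/-! ## 3. The axial neutral quasimodes -/

/-- Derivative of the oscillating shape `χ₀(t)·cos(at)`. -/
theorem hasDerivAt_bump12_mul_cos (a t : ℝ) :
    HasDerivAt (fun t => bump12 t * Real.cos (a * t)) (deriv bump12 t * Real.cos (a * t) - a * (bump12 t * Real.sin (a * t))) t := by
  have hb : HasDerivAt bump12 (deriv bump12 t) t :=
    (((contDiff_bump12 (n := 1)).differentiable (by norm_num)) t).hasDerivAt
  have hc : HasDerivAt (fun t => Real.cos (a * t)) (-Real.sin (a * t) * a) t := by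
    have h := ((hasDerivAt_id t).const_mul a).cos
    simpa using h
  refine (hb.mul hc).congr_deriv ?_
  ring

/-- Derivative of the oscillating shape `χ₀(t)·sin(at)`. -/
theorem hasDerivAt_bump12_mul_sin (a t : ℝ) :
    HasDerivAt (fun t => bump12 t * Real.sin (a * t)) (deriv bump12 t * Real.sin (a * t) + a * (bump12 t * Real.cos (a * t))) t := by
  have hb : HasDerivAt bump12 (deriv bump12 t) t :=
    (((contDiff_bump12 (n := 1)).differentiable (by norm_num)) t).hasDerivAt
  have hs : HasDerivAt (fun t => Real.sin (a * t)) (Real.cos (a * t) * a) t := by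
    have h := ((hasDerivAt_id t).const_mul a).sin
    simpa using h
  refine (hb.mul hs).congr_deriv ?_
  ring

/-- **AXIAL NEUTRAL QUASIMODES.**  For every axial strain `κ > 0`, every real frequency `ν` and every `ε > 0` there are smooth real
profiles `f, g` (the real and imaginary parts of `χ₀(log(x/X)/L)·(x/X)^{iν/κ}`), vanishing on `|x| ≤ 1` and outside a compact set, with
`f² + g² ≤ 1` everywhere and `f² + g² = χ₀(3/2)² > 0` at some point, such that
`|κ x f′ − f″ + ν g| ≤ ε` and `|κ x g′ − g″ − ν f| ≤ ε` everywhere, i.e. `‖(κx∂ₓ − ∂ₓ² − iν)(f + ig)‖_∞ ≤ ε`: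
the axial transport–diffusion operator of the frozen waist column has every `iν` in its approximate point spectrum on bounded
smooth compactly supported profiles. -/
theorem axial_neutral_quasimodes {κ : ℝ} (hκ : 0 < κ) (ν : ℝ) {ε : ℝ} (hε : 0 < ε) :
    ∃ f g : ℝ → ℝ, ContDiff ℝ ∞ f ∧ ContDiff ℝ ∞ g ∧
      (∀ x, |x| ≤ 1 → f x = 0 ∧ g x = 0) ∧
      (∃ R : ℝ, ∀ x, R ≤ |x| → f x = 0 ∧ g x = 0) ∧
      (∀ x, f x ^ 2 + g x ^ 2 ≤ 1) ∧
      (∃ x₀, f x₀ ^ 2 + g x₀ ^ 2 = bump12 (3/2) ^ 2) ∧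
      (∀ x, |κ * x * deriv f x - deriv (deriv f) x + ν * g x| ≤ ε) ∧
      (∀ x, |κ * x * deriv g x - deriv (deriv g) x - ν * f x| ≤ ε) := by
  obtain ⟨M₁, hM₁0, hM₁⟩ := exists_bound_deriv_bump12
  set c : ℝ := ν / κ with hc
  set L : ℝ := 2 * κ * M₁ / ε + 1 with hL
  have hL0 : 0 < L := by positivity
  have hLne : L ≠ 0 := hL0.ne'
  have hκc : κ * c = ν := by rw [hc]; field_simp
  -- the two shapes
  set ψc : ℝ → ℝ := fun t => bump12 t * Real.cos (c * L * t) with hψc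
  set ψs : ℝ → ℝ := fun t => bump12 t * Real.sin (c * L * t) with hψs
  have hψc_smooth : ContDiff ℝ ∞ ψc :=
    contDiff_bump12.mul (Real.contDiff_cos.comp (contDiff_const.mul contDiff_id))
  have hψs_smooth : ContDiff ℝ ∞ ψs :=
    contDiff_bump12.mul (Real.contDiff_sin.comp (contDiff_const.mul contDiff_id))
  have hψc1 : ∀ t, t < 1 → ψc t = 0 := fun t ht => by simp [hψc, bump12_eq_zero_of_le_one ht.le]
  have hψc2 : ∀ t, 2 < t → ψc t = 0 := fun t ht => by simp [hψc, bump12_eq_zero_of_two_le ht.le]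
  have hψs1 : ∀ t, t < 1 → ψs t = 0 := fun t ht => by simp [hψs, bump12_eq_zero_of_le_one ht.le]
  have hψs2 : ∀ t, 2 < t → ψs t = 0 := fun t ht => by simp [hψs, bump12_eq_zero_of_two_le ht.le]
  have hdc : ∀ t, deriv ψc t = deriv bump12 t * Real.cos (c * L * t) - c * L * (bump12 t * Real.sin (c * L * t)) :=
    fun t => (hasDerivAt_bump12_mul_cos (c * L) t).deriv
  have hds : ∀ t, deriv ψs t = deriv bump12 t * Real.sin (c * L * t) + c * L * (bump12 t * Real.cos (c * L * t)) :=
    fun t => (hasDerivAt_bump12_mul_sin (c * L) t).deriv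
  obtain ⟨Mc, hMc0, hPc⟩ := logProfile_package hψc_smooth hψc1 hψc2 hL0
  obtain ⟨Ms, hMs0, hPs⟩ := logProfile_package hψs_smooth hψs1 hψs2 hL0
  -- the dilation
  set X : ℝ := 2 * (Mc + Ms) / ε + 1 with hX
  have hX0 : 0 < X := by positivity
  have hX1 : 1 ≤ X := by
    have : 0 ≤ 2 * (Mc + Ms) / ε := by positivity
    linarith
  obtain ⟨hfc, hfe, hf2⟩ := hPc X hX0
  obtain ⟨hgc, hge, hg2⟩ := hPs X hX0
  -- the two error budgets
  have hbudget1 : κ * M₁ / L ≤ ε / 2 := by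
    rw [div_le_iff₀ hL0]
    have : ε / 2 * L = κ * M₁ + ε / 2 := by rw [hL]; field_simp
    nlinarith
  have hbudget2 : (Mc + Ms) / X ^ 2 ≤ ε / 2 := by
    have hXX : X ≤ X ^ 2 := by nlinarith
    have h1 : (Mc + Ms) / X ^ 2 ≤ (Mc + Ms) / X := div_le_div_of_nonneg_left (by positivity) hX0 hXX
    have h2 : (Mc + Ms) / X ≤ ε / 2 := by
      rw [div_le_iff₀ hX0]
      have : ε / 2 * X = (Mc + Ms) + ε / 2 := by rw [hX]; field_simp
      nlinarith
    exact h1.trans h2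
  have hsmall : ∀ (t : ℝ) (trig : ℝ), |trig| ≤ 1 → |κ / L * (deriv bump12 t * trig)| ≤ ε / 2 := by
    intro t trig htrig
    rw [abs_mul, abs_mul, abs_of_pos (div_pos hκ hL0)]
    calc κ / L * (|deriv bump12 t| * |trig|) ≤ κ / L * (M₁ * 1) := by
          gcongr
          exact hM₁ t
      _ = κ * M₁ / L := by ring
      _ ≤ ε / 2 := hbudget1
  refine ⟨fun x => ψc (Real.log (x / X) / L), fun x => ψs (Real.log (x / X) / L), hfc, hgc, ?_, ?_, ?_, ?_, ?_, ?_⟩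
  · -- vanishing on `|x| ≤ 1`
    intro x hx
    have ht : Real.log (x / X) / L < 1 := by
      have h1 : |x / X| ≤ 1 := by
        rw [abs_div, abs_of_pos hX0]; exact (div_le_one hX0).mpr (hx.trans hX1)
      have hlog : Real.log (x / X) ≤ 0 := by
        rw [← Real.log_abs]; exact Real.log_nonpos (abs_nonneg _) h1
      have : Real.log (x / X) / L ≤ 0 := div_nonpos_of_nonpos_of_nonneg hlog hL0.le
      linarith
    exact ⟨hψc1 _ ht, hψs1 _ ht⟩
  · -- vanishing for `X·e^{3L} ≤ |x|`
    refine ⟨X * Real.exp (3 * L), fun x hx => ?_⟩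
    have ht : 2 < Real.log (x / X) / L := by
      have h1 : Real.exp (3 * L) ≤ |x / X| := by
        rw [abs_div, abs_of_pos hX0, le_div_iff₀ hX0]
        linarith
      have hlog : 3 * L ≤ Real.log (x / X) := by
        rw [← Real.log_abs, ← Real.log_exp (3 * L)]
        exact Real.log_le_log (Real.exp_pos _) h1
      rw [lt_div_iff₀ hL0]
      linarith
    exact ⟨hψc2 _ ht, hψs2 _ ht⟩
  · -- size at most one
    intro x
    have hb0 := bump12_nonneg (Real.log (x / X) / L)
    have hb1 := bump12_le_one (Real.log (x / X) / L)
    have e : ψc (Real.log (x / X) / L) ^ 2 + ψs (Real.log (x / X) / L) ^ 2 = bump12 (Real.log (x / X) / L) ^ 2 := by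
      simp only [hψc, hψs]
      rw [mul_pow, mul_pow, ← mul_add, Real.cos_sq_add_sin_sq, mul_one]
    rw [e]
    nlinarith
  · -- the point `x₀ = X·e^{3L/2}`
    refine ⟨X * Real.exp (3 / 2 * L), ?_⟩
    have ht : Real.log (X * Real.exp (3 / 2 * L) / X) / L = 3 / 2 := by
      rw [mul_div_cancel_left₀ _ hX0.ne', Real.log_exp]
      field_simp
    simp only [ht, hψc, hψs]
    rw [mul_pow, mul_pow, ← mul_add, Real.cos_sq_add_sin_sq, mul_one]
  · -- the `f`-equation: `κ x f′ + ν g = (κ/L)·χ₀′·cos`, `|f″| ≤ M_c/X²`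
    intro x
    have h1 : κ * x * deriv (fun x => ψc (Real.log (x / X) / L)) x + ν * ψs (Real.log (x / X) / L)
        = κ / L * (deriv bump12 (Real.log (x / X) / L) * Real.cos (c * L * (Real.log (x / X) / L))) := by
      rw [mul_assoc, hfe x]
      simp only [eulerStep, Nat.cast_zero, zero_mul, sub_zero, hdc, hψs]
      rw [← hκc]
      field_simp
      ring
    have h2 := hsmall (Real.log (x / X) / L) _ (Real.abs_cos_le_one (c * L * (Real.log (x / X) / L)))
    have h3 : |deriv (deriv (fun x => ψc (Real.log (x / X) / L))) x| ≤ ε / 2 :=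
      (hf2 x).trans ((div_le_div_of_nonneg_right (by linarith) (by positivity)).trans hbudget2)
    calc |κ * x * deriv (fun x => ψc (Real.log (x / X) / L)) x - deriv (deriv (fun x => ψc (Real.log (x / X) / L))) x
            + ν * ψs (Real.log (x / X) / L)|
        = |(κ * x * deriv (fun x => ψc (Real.log (x / X) / L)) x + ν * ψs (Real.log (x / X) / L))
            - deriv (deriv (fun x => ψc (Real.log (x / X) / L))) x| := by rw [sub_add_eq_add_sub]
      _ ≤ |κ * x * deriv (fun x => ψc (Real.log (x / X) / L)) x + ν * ψs (Real.log (x / X) / L)|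
            + |deriv (deriv (fun x => ψc (Real.log (x / X) / L))) x| := abs_sub _ _
      _ ≤ ε / 2 + ε / 2 := by rw [h1]; exact add_le_add h2 h3
      _ = ε := by ring
  · -- the `g`-equation: `κ x g′ − ν f = (κ/L)·χ₀′·sin`, `|g″| ≤ M_s/X²`
    intro x
    have h1 : κ * x * deriv (fun x => ψs (Real.log (x / X) / L)) x - ν * ψc (Real.log (x / X) / L)
        = κ / L * (deriv bump12 (Real.log (x / X) / L) * Real.sin (c * L * (Real.log (x / X) / L))) := by
      rw [mul_assoc, hge x]
      simp only [eulerStep, Nat.cast_zero, zero_mul, sub_zero, hds, hψc]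
      rw [← hκc]
      field_simp
      ring
    have h2 := hsmall (Real.log (x / X) / L) _ (Real.abs_sin_le_one (c * L * (Real.log (x / X) / L)))
    have h3 : |deriv (deriv (fun x => ψs (Real.log (x / X) / L))) x| ≤ ε / 2 :=
      (hg2 x).trans ((div_le_div_of_nonneg_right (by linarith) (by positivity)).trans hbudget2)
    calc |κ * x * deriv (fun x => ψs (Real.log (x / X) / L)) x - deriv (deriv (fun x => ψs (Real.log (x / X) / L))) x
            - ν * ψc (Real.log (x / X) / L)|
        = |(κ * x * deriv (fun x => ψs (Real.log (x / X) / L)) x - ν * ψc (Real.log (x / X) / L))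
            - deriv (deriv (fun x => ψs (Real.log (x / X) / L))) x| := by rw [sub_right_comm]
      _ ≤ |κ * x * deriv (fun x => ψs (Real.log (x / X) / L)) x - ν * ψc (Real.log (x / X) / L)|
            + |deriv (deriv (fun x => ψs (Real.log (x / X) / L))) x| := abs_sub _ _
      _ ≤ ε / 2 + ε / 2 := by rw [h1]; exact add_le_add h2 h3
      _ = ε := by ring

end Summit.NavierStokesRegularity.NavierStokesRegularity.Theorems.DefectColumnGate

end
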